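import Mathlib
import Summits.NavierStokesRegularity.NavierStokesRegularity.Theses.MeanFieldTypeI
import HarnessLib

/-!
# `MeanFieldTypeI.Assembly` — the route's assembly (item stmt-NavierStokesRegularity-1688; pure logic)

**Statement.** `StatisticalTypeILiouville → TypeIBlowupGivesStatistics → NoTypeII → NoBlowupToClay →
NavierStokesRegularity` (signatures expanded in the route file).

PROOF (the planner's `assembly_holds`). To get Clay (A) apply `NoBlowupToClay`; given a finite-energy
classical solution from Clay data, if it had no smooth extension past `T` it is maximal
(`IsMaximalSmoothSolution` = classical ∧ no extension), `NoTypeII` gives the Type-I rate,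
`TypeIBlowupGivesStatistics` a non-trivial scaling-stationary `μ` on some `K(C, M)` with `M < ⊤`,
and `StatisticalTypeILiouville` says `μ` is trivial — contradiction.

HONEST FRAMING: glue between the route's own statements (about HYPOTHETICAL objects); nothing
here bears on the regularity problem itself.
-/

noncomputable section

set_option linter.dupNamespace false

namespace Summit.NavierStokesRegularity.NavierStokesRegularity.Theorems

/-- **Item stmt-NavierStokesRegularity-1688** (`MeanFieldTypeI.Assembly`): statistical Type-I
Liouville + statistics of a Type-I blow-up + no Type II give no blow-up, and `NoBlowupToClay`
concludes. [this file] -/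
theorem meanFieldTypeI_assembly_proof :
    Summit.NavierStokesRegularity.NavierStokesRegularity.Theses.MeanFieldTypeI.Assembly := by
  unfold Summit.NavierStokesRegularity.NavierStokesRegularity.Theses.MeanFieldTypeI.Assembly
  intro hL hS hII hClay
  refine hClay fun ν T hν hT u p hcl hLH hdec => ?_
  by_contra hext
  have hmax : Literature.Analysis.FluidPDE.IsMaximalSmoothSolution ν 0 u p T := ⟨hcl, hext⟩
  obtain ⟨C, M, μ, hM, hprob, hinv, hsupp, hnontriv⟩ :=
    hS ν T hν hT u p hcl hLH hdec hext (hII ν T hν hT u p hmax hLH hdec)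
  exact hnontriv (hL C M μ hM hprob hinv hsupp)

end Summit.NavierStokesRegularity.NavierStokesRegularity.Theorems

end
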